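import Mathlib
import Literature.Geometry.Lorentzian.Basic

/-!
# Route EIHFluxBalance — item `WeightedQuasiStationarity` (stmt-FinalStateConjecture-16928),
# negative lane: calculus of the witness (damped oscillation `(1+t²)ᵖ sin t` and its three derivatives)

Helper file (1/3) of the kinematic-shadow refutation
`…WeightedQuasiStationarity.Negative.KinematicShadow.not_weightedQuasiStationarity_kinematicShadow`
(`--supports stmt-FinalStateConjecture-16928`; no Theses decl is asserted). Pure one-variable calculus:

* §1 the product chain `A sin → A' sin + A cos → …` for an abstract amplitude `A` with three
  derivatives, and the limits when `A, A', A'', A''' → 0`;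
* §2 the lab velocity `w = (ε A sin) • e ∈ E3`: closed forms of `iteratedDeriv m w`, `m ≤ 3`, and
  their convergence to `0`;
* §4 the concrete amplitude `A(t) = (1 + t²)ᵖ`, `p < 0`: `HasDerivAt` chain of length three and the
  four limits (every term is `c tᵏ (1+t²)^{p-j}`, `k ≤ j`, bounded by `|c|(1+t²)ᵖ`).
-/

set_option linter.dupNamespace false

noncomputable section

namespace Summit.FinalStateConjecture.FinalStateConjecture.Theorems.WeightedQuasiStationarity.Negative

open scoped Topology
open Filter Set Function Metric Literature.Geometry.Lorentzian

/-! ### §1 Scalar calculus: a damped oscillation `A(t) sin t` with three vanishing derivatives -/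

/-- First derivative of `A sin`. [folklore] -/
theorem hasDerivAt_osc0 {A A1 : ℝ → ℝ} (hA : ∀ t, HasDerivAt A (A1 t) t) (t : ℝ) :
    HasDerivAt (fun s ↦ A s * Real.sin s) (A1 t * Real.sin t + A t * Real.cos t) t :=
  (hA t).mul (Real.hasDerivAt_sin t)

/-- Second derivative of `A sin`. [folklore] -/
theorem hasDerivAt_osc1 {A A1 A2 : ℝ → ℝ} (hA : ∀ t, HasDerivAt A (A1 t) t)
    (hA1 : ∀ t, HasDerivAt A1 (A2 t) t) (t : ℝ) :
    HasDerivAt (fun s ↦ A1 s * Real.sin s + A s * Real.cos s)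
      (A2 t * Real.sin t + 2 * A1 t * Real.cos t - A t * Real.sin t) t := by
  have h := ((hA1 t).mul (Real.hasDerivAt_sin t)).add ((hA t).mul (Real.hasDerivAt_cos t))
  exact h.congr_deriv (by ring)

/-- Third derivative of `A sin`. [folklore] -/
theorem hasDerivAt_osc2 {A A1 A2 A3 : ℝ → ℝ} (hA : ∀ t, HasDerivAt A (A1 t) t)
    (hA1 : ∀ t, HasDerivAt A1 (A2 t) t) (hA2 : ∀ t, HasDerivAt A2 (A3 t) t) (t : ℝ) :
    HasDerivAt (fun s ↦ A2 s * Real.sin s + 2 * A1 s * Real.cos s - A s * Real.sin s)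
      (A3 t * Real.sin t + 3 * A2 t * Real.cos t - 3 * A1 t * Real.sin t - A t * Real.cos t) t := by
  have h := (((hA2 t).mul (Real.hasDerivAt_sin t)).add
    (((hA1 t).const_mul 2).mul (Real.hasDerivAt_cos t))).sub ((hA t).mul (Real.hasDerivAt_sin t))
  exact h.congr_deriv (by ring)

/-- A product with a factor tending to `0` and a factor bounded by `1` in absolute value tends to `0`.
[folklore] -/
theorem tendsto_mul_bounded_zero {f g : ℝ → ℝ} (hf : Tendsto f atTop (𝓝 0))
    (hg : ∀ t, |g t| ≤ 1) : Tendsto (fun t ↦ f t * g t) atTop (𝓝 0) := by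
  refine hf.zero_mul_isBoundedUnder_le ?_
  exact Filter.isBoundedUnder_of ⟨1, fun t ↦ by simpa [Real.norm_eq_abs] using hg t⟩

/-! ### §2 The lab velocity `w = (ε A sin) • e` and its three derivatives -/

/-- Derivatives of `s ↦ c(s) • e` for a scalar `c`. [folklore] -/
theorem hasDerivAt_smul_vec {c c' : ℝ → ℝ} (hc : ∀ t, HasDerivAt c (c' t) t) (e : E3) (t : ℝ) :
    HasDerivAt (fun s ↦ c s • e) (c' t • e) t :=
  (hc t).smul_const e

/-- `deriv` of `s ↦ c(s) • e`. [folklore] -/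
theorem deriv_smul_vec {c c' : ℝ → ℝ} (hc : ∀ t, HasDerivAt c (c' t) t) (e : E3) :
    deriv (fun s ↦ c s • e) = fun t ↦ c' t • e :=
  funext fun t ↦ (hasDerivAt_smul_vec hc e t).deriv

/-- The three iterated derivatives of `w = (ε A sin) • e` in closed form. [folklore] -/
theorem iteratedDeriv_w {A A1 A2 A3 : ℝ → ℝ} (hA : ∀ t, HasDerivAt A (A1 t) t)
    (hA1 : ∀ t, HasDerivAt A1 (A2 t) t) (hA2 : ∀ t, HasDerivAt A2 (A3 t) t) (ε : ℝ) (e : E3) :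
    iteratedDeriv 1 (fun s ↦ (ε * (A s * Real.sin s)) • e) =
        (fun t ↦ (ε * (A1 t * Real.sin t + A t * Real.cos t)) • e) ∧
      iteratedDeriv 2 (fun s ↦ (ε * (A s * Real.sin s)) • e) =
        (fun t ↦ (ε * (A2 t * Real.sin t + 2 * A1 t * Real.cos t - A t * Real.sin t)) • e) ∧
      iteratedDeriv 3 (fun s ↦ (ε * (A s * Real.sin s)) • e) =
        (fun t ↦ (ε * (A3 t * Real.sin t + 3 * A2 t * Real.cos t - 3 * A1 t * Real.sin t -
          A t * Real.cos t)) • e) := by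
  have h0 : ∀ t, HasDerivAt (fun s ↦ ε * (A s * Real.sin s))
      (ε * (A1 t * Real.sin t + A t * Real.cos t)) t := fun t ↦ (hasDerivAt_osc0 hA t).const_mul ε
  have h1 : ∀ t, HasDerivAt (fun s ↦ ε * (A1 s * Real.sin s + A s * Real.cos s))
      (ε * (A2 t * Real.sin t + 2 * A1 t * Real.cos t - A t * Real.sin t)) t :=
    fun t ↦ (hasDerivAt_osc1 hA hA1 t).const_mul ε
  have h2 : ∀ t, HasDerivAt (fun s ↦ ε * (A2 s * Real.sin s + 2 * A1 s * Real.cos s - A s * Real.sin s))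
      (ε * (A3 t * Real.sin t + 3 * A2 t * Real.cos t - 3 * A1 t * Real.sin t - A t * Real.cos t)) t :=
    fun t ↦ (hasDerivAt_osc2 hA hA1 hA2 t).const_mul ε
  have e1 : iteratedDeriv 1 (fun s ↦ (ε * (A s * Real.sin s)) • e) =
      (fun t ↦ (ε * (A1 t * Real.sin t + A t * Real.cos t)) • e) := by
    rw [iteratedDeriv_one, deriv_smul_vec h0 e]
  have e2 : iteratedDeriv 2 (fun s ↦ (ε * (A s * Real.sin s)) • e) =
      (fun t ↦ (ε * (A2 t * Real.sin t + 2 * A1 t * Real.cos t - A t * Real.sin t)) • e) := by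
    rw [iteratedDeriv_succ, e1, deriv_smul_vec h1 e]
  have e3 : iteratedDeriv 3 (fun s ↦ (ε * (A s * Real.sin s)) • e) =
      (fun t ↦ (ε * (A3 t * Real.sin t + 3 * A2 t * Real.cos t - 3 * A1 t * Real.sin t -
        A t * Real.cos t)) • e) := by
    rw [iteratedDeriv_succ, e2, deriv_smul_vec h2 e]
  exact ⟨e1, e2, e3⟩

/-- If `A, A', A'', A''' → 0` then `w = (ε A sin) • e` and its first three derivatives tend to `0`.
[folklore] -/
theorem tendsto_iteratedDeriv_w {A A1 A2 A3 : ℝ → ℝ} (hA : ∀ t, HasDerivAt A (A1 t) t)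
    (hA1 : ∀ t, HasDerivAt A1 (A2 t) t) (hA2 : ∀ t, HasDerivAt A2 (A3 t) t)
    (l0 : Tendsto A atTop (𝓝 0)) (l1 : Tendsto A1 atTop (𝓝 0)) (l2 : Tendsto A2 atTop (𝓝 0))
    (l3 : Tendsto A3 atTop (𝓝 0)) (ε : ℝ) (e : E3) :
    ∀ m ≤ 3, Tendsto (fun t ↦ iteratedDeriv m (fun s ↦ (ε * (A s * Real.sin s)) • e) t)
      atTop (𝓝 0) := by
  obtain ⟨e1, e2, e3⟩ := iteratedDeriv_w hA hA1 hA2 ε e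
  have hs : ∀ t, |Real.sin t| ≤ 1 := fun t ↦ Real.abs_sin_le_one t
  have hc : ∀ t, |Real.cos t| ≤ 1 := fun t ↦ Real.abs_cos_le_one t
  -- the four scalar limits
  have m0 : Tendsto (fun t ↦ A t * Real.sin t) atTop (𝓝 0) := tendsto_mul_bounded_zero l0 hs
  have m1 : Tendsto (fun t ↦ A1 t * Real.sin t + A t * Real.cos t) atTop (𝓝 0) := by
    simpa using (tendsto_mul_bounded_zero l1 hs).add (tendsto_mul_bounded_zero l0 hc)
  have m2 : Tendsto (fun t ↦ A2 t * Real.sin t + 2 * A1 t * Real.cos t - A t * Real.sin t)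
      atTop (𝓝 0) := by
    have h := ((tendsto_mul_bounded_zero l2 hs).add
      ((tendsto_mul_bounded_zero l1 hc).const_mul 2)).sub (tendsto_mul_bounded_zero l0 hs)
    simp only [mul_zero, add_zero, sub_zero] at h
    refine h.congr fun t ↦ ?_
    ring
  have m3 : Tendsto (fun t ↦ A3 t * Real.sin t + 3 * A2 t * Real.cos t - 3 * A1 t * Real.sin t -
      A t * Real.cos t) atTop (𝓝 0) := by
    have h := (((tendsto_mul_bounded_zero l3 hs).add
      ((tendsto_mul_bounded_zero l2 hc).const_mul 3)).sub
      ((tendsto_mul_bounded_zero l1 hs).const_mul 3)).sub (tendsto_mul_bounded_zero l0 hc)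
    simp only [mul_zero, add_zero, sub_zero] at h
    refine h.congr fun t ↦ ?_
    ring
  have key : ∀ {f : ℝ → ℝ}, Tendsto f atTop (𝓝 0) →
      Tendsto (fun t ↦ (ε * f t) • e) atTop (𝓝 0) := by
    intro f hf
    simpa using (hf.const_mul ε).smul_const e
  intro m hm
  interval_cases m
  · simpa [iteratedDeriv_zero] using key m0
  · rw [e1]; exact key m1
  · rw [e2]; exact key m2
  · rw [e3]; exact key m3


/-! ### §4 The amplitude `A(t) = (1 + t²)ᵖ`, `p < 0`: three derivatives, all tending to `0` -/

/-- `1 ≤ 1 + t²`. [folklore] -/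
theorem one_le_one_add_sq (t : ℝ) : 1 ≤ 1 + t ^ 2 := by nlinarith [sq_nonneg t]

/-- `d/dt (1 + t²) = 2t`. [folklore] -/
theorem hasDerivAt_one_add_sq (t : ℝ) : HasDerivAt (fun s : ℝ ↦ 1 + s ^ 2) (2 * t) t := by
  simpa using ((hasDerivAt_id' t).pow 2).const_add 1

/-- First derivative of the amplitude: `A' = 2pt (1+t²)^{p-1}`. [folklore] -/
theorem hasDerivAt_ampl0 (p t : ℝ) :
    HasDerivAt (fun s : ℝ ↦ (1 + s ^ 2) ^ p) (2 * t * p * (1 + t ^ 2) ^ (p - 1)) t :=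
  (hasDerivAt_one_add_sq t).rpow_const (Or.inl (by positivity : (0 : ℝ) < 1 + t ^ 2).ne')

/-- Second derivative of the amplitude: `A'' = 2p (1+t²)^{p-1} + 4p(p-1) t² (1+t²)^{p-2}`.
[folklore] -/
theorem hasDerivAt_ampl1 (p t : ℝ) :
    HasDerivAt (fun s : ℝ ↦ 2 * s * p * (1 + s ^ 2) ^ (p - 1))
      (2 * p * (1 + t ^ 2) ^ (p - 1) + 4 * p * (p - 1) * t ^ 2 * (1 + t ^ 2) ^ (p - 2)) t := by
  have h1 : HasDerivAt (fun s : ℝ ↦ 2 * s * p) (2 * p) t := by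
    simpa using ((hasDerivAt_id' t).const_mul 2).mul_const p
  have h2 : HasDerivAt (fun s : ℝ ↦ (1 + s ^ 2) ^ (p - 1))
      (2 * t * (p - 1) * (1 + t ^ 2) ^ (p - 1 - 1)) t :=
    (hasDerivAt_one_add_sq t).rpow_const (Or.inl (by positivity : (0 : ℝ) < 1 + t ^ 2).ne')
  have h := h1.mul h2
  refine h.congr_deriv ?_
  rw [show p - 1 - 1 = p - 2 by ring]
  ring

/-- Third derivative of the amplitude:
`A⁽³⁾ = 12p(p-1) t (1+t²)^{p-2} + 8p(p-1)(p-2) t³ (1+t²)^{p-3}`. [folklore] -/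
theorem hasDerivAt_ampl2 (p t : ℝ) :
    HasDerivAt (fun s : ℝ ↦ 2 * p * (1 + s ^ 2) ^ (p - 1) +
        4 * p * (p - 1) * s ^ 2 * (1 + s ^ 2) ^ (p - 2))
      (12 * p * (p - 1) * t * (1 + t ^ 2) ^ (p - 2) +
        8 * p * (p - 1) * (p - 2) * t ^ 3 * (1 + t ^ 2) ^ (p - 3)) t := by
  have h2 : HasDerivAt (fun s : ℝ ↦ (1 + s ^ 2) ^ (p - 1))
      (2 * t * (p - 1) * (1 + t ^ 2) ^ (p - 1 - 1)) t :=
    (hasDerivAt_one_add_sq t).rpow_const (Or.inl (by positivity : (0 : ℝ) < 1 + t ^ 2).ne')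
  have h3 : HasDerivAt (fun s : ℝ ↦ (1 + s ^ 2) ^ (p - 2))
      (2 * t * (p - 2) * (1 + t ^ 2) ^ (p - 2 - 1)) t :=
    (hasDerivAt_one_add_sq t).rpow_const (Or.inl (by positivity : (0 : ℝ) < 1 + t ^ 2).ne')
  have h4 : HasDerivAt (fun s : ℝ ↦ 4 * p * (p - 1) * s ^ 2) (4 * p * (p - 1) * (2 * t)) t := by
    simpa using ((hasDerivAt_id' t).pow 2).const_mul (4 * p * (p - 1))
  have h := (h2.const_mul (2 * p)).add (h4.mul h3)
  refine h.congr_deriv ?_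
  rw [show p - 1 - 1 = p - 2 by ring, show p - 2 - 1 = p - 3 by ring]
  ring

/-- Monotonicity of `q ↦ (1+t²)^q`. [folklore] -/
theorem rpow_one_add_sq_mono (t : ℝ) {q q' : ℝ} (h : q ≤ q') :
    (1 + t ^ 2) ^ q ≤ (1 + t ^ 2) ^ q' :=
  Real.rpow_le_rpow_of_exponent_le (one_le_one_add_sq t) h

/-- `|t|ᵏ (1+t²)^{q-k} ≤ (1+t²)^q`. [folklore] -/
theorem abs_pow_mul_rpow_le (t q : ℝ) (k : ℕ) :
    |t| ^ k * (1 + t ^ 2) ^ (q - k) ≤ (1 + t ^ 2) ^ q := by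
  have hf : (0 : ℝ) < 1 + t ^ 2 := by positivity
  have habs : |t| ≤ 1 + t ^ 2 := by
    cases abs_cases t <;> nlinarith [sq_nonneg (t - 1), sq_nonneg (t + 1)]
  have h1 : |t| ^ k ≤ (1 + t ^ 2) ^ k := pow_le_pow_left₀ (abs_nonneg t) habs k
  calc |t| ^ k * (1 + t ^ 2) ^ (q - k) ≤ (1 + t ^ 2) ^ k * (1 + t ^ 2) ^ (q - k) :=
        mul_le_mul_of_nonneg_right h1 (Real.rpow_nonneg hf.le _)
    _ = (1 + t ^ 2) ^ q := by
        rw [← Real.rpow_natCast, ← Real.rpow_add hf]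
        ring_nf

/-- `(1+t²)ᵖ → 0` as `t → ∞` for `p < 0`. [folklore] -/
theorem tendsto_rpow_one_add_sq {p : ℝ} (hp : p < 0) :
    Tendsto (fun t : ℝ ↦ (1 + t ^ 2) ^ p) atTop (𝓝 0) := by
  have h1 : Tendsto (fun x : ℝ ↦ x ^ p) atTop (𝓝 0) := by
    have := tendsto_rpow_neg_atTop (neg_pos.mpr hp)
    simpa using this
  have h2 : Tendsto (fun t : ℝ ↦ 1 + t ^ 2) atTop atTop :=
    tendsto_atTop_add_const_left _ _ (tendsto_pow_atTop two_ne_zero)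
  exact h1.comp h2

/-- Squeeze: `|g| ≤ K (1+t²)ᵖ` with `p < 0` forces `g → 0`. [folklore] -/
theorem tendsto_zero_of_le_rpow {g : ℝ → ℝ} {K p : ℝ} (hp : p < 0)
    (h : ∀ t, |g t| ≤ K * (1 + t ^ 2) ^ p) : Tendsto g atTop (𝓝 0) := by
  refine squeeze_zero_norm (fun t ↦ ?_) (by simpa using (tendsto_rpow_one_add_sq hp).const_mul K)
  rw [Real.norm_eq_abs]
  exact h t

/-- The amplitude and its first three derivatives tend to `0` (`p < 0`): every term is
`c tᵏ (1+t²)^{p-j}` with `k ≤ j`, bounded by `|c| (1+t²)ᵖ` (`|t| ≤ 1 + t²`). [folklore] -/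
theorem tendsto_ampl {p : ℝ} (hp : p < 0) :
    Tendsto (fun t : ℝ ↦ (1 + t ^ 2) ^ p) atTop (𝓝 0) ∧
    Tendsto (fun t : ℝ ↦ 2 * t * p * (1 + t ^ 2) ^ (p - 1)) atTop (𝓝 0) ∧
    Tendsto (fun t : ℝ ↦ 2 * p * (1 + t ^ 2) ^ (p - 1) +
      4 * p * (p - 1) * t ^ 2 * (1 + t ^ 2) ^ (p - 2)) atTop (𝓝 0) ∧
    Tendsto (fun t : ℝ ↦ 12 * p * (p - 1) * t * (1 + t ^ 2) ^ (p - 2) +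
        8 * p * (p - 1) * (p - 2) * t ^ 3 * (1 + t ^ 2) ^ (p - 3)) atTop (𝓝 0) := by
  have hfq : ∀ (t q : ℝ), 0 ≤ (1 + t ^ 2) ^ q := fun t q ↦ Real.rpow_nonneg (by positivity) _
  -- the elementary term bounds
  have b1 : ∀ t : ℝ, |t| * (1 + t ^ 2) ^ (p - 1) ≤ (1 + t ^ 2) ^ p := fun t ↦ by
    simpa using abs_pow_mul_rpow_le t p 1
  have b2 : ∀ t : ℝ, t ^ 2 * (1 + t ^ 2) ^ (p - 2) ≤ (1 + t ^ 2) ^ p := fun t ↦ by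
    have h := abs_pow_mul_rpow_le t p 2
    rw [sq_abs] at h
    norm_num at h
    exact h
  have b3 : ∀ t : ℝ, |t| ^ 3 * (1 + t ^ 2) ^ (p - 3) ≤ (1 + t ^ 2) ^ p := fun t ↦ by
    have h := abs_pow_mul_rpow_le t p 3
    norm_num at h
    exact h
  have b1' : ∀ t : ℝ, |t| * (1 + t ^ 2) ^ (p - 2) ≤ (1 + t ^ 2) ^ p := fun t ↦ by
    have h := abs_pow_mul_rpow_le t (p - 1) 1
    simp only [pow_one, Nat.cast_one] at h
    rw [show p - 1 - 1 = p - 2 by ring] at h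
    exact h.trans (rpow_one_add_sq_mono t (by linarith))
  have b0' : ∀ t : ℝ, (1 + t ^ 2) ^ (p - 1) ≤ (1 + t ^ 2) ^ p := fun t ↦
    rpow_one_add_sq_mono t (by linarith)
  refine ⟨tendsto_rpow_one_add_sq hp, ?_, ?_, ?_⟩
  · refine tendsto_zero_of_le_rpow (K := 2 * |p|) hp fun t ↦ ?_
    calc |2 * t * p * (1 + t ^ 2) ^ (p - 1)| = 2 * |p| * (|t| * (1 + t ^ 2) ^ (p - 1)) := by
          simp only [abs_mul, abs_of_nonneg (hfq t _), abs_two]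
          ring
      _ ≤ 2 * |p| * (1 + t ^ 2) ^ p := mul_le_mul_of_nonneg_left (b1 t) (by positivity)
  · refine tendsto_zero_of_le_rpow (K := 2 * |p| + 4 * |p| * |p - 1|) hp fun t ↦ ?_
    calc |2 * p * (1 + t ^ 2) ^ (p - 1) + 4 * p * (p - 1) * t ^ 2 * (1 + t ^ 2) ^ (p - 2)|
        ≤ |2 * p * (1 + t ^ 2) ^ (p - 1)| + |4 * p * (p - 1) * t ^ 2 * (1 + t ^ 2) ^ (p - 2)| :=
          abs_add_le _ _
      _ = 2 * |p| * (1 + t ^ 2) ^ (p - 1) +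
            4 * |p| * |p - 1| * (t ^ 2 * (1 + t ^ 2) ^ (p - 2)) := by
          simp only [abs_mul, abs_of_nonneg (hfq t _), abs_two, abs_pow, sq_abs]
          norm_num
          ring
      _ ≤ 2 * |p| * (1 + t ^ 2) ^ p + 4 * |p| * |p - 1| * (1 + t ^ 2) ^ p :=
          add_le_add (mul_le_mul_of_nonneg_left (b0' t) (by positivity))
            (mul_le_mul_of_nonneg_left (b2 t) (by positivity))
      _ = (2 * |p| + 4 * |p| * |p - 1|) * (1 + t ^ 2) ^ p := by ring
  · refine tendsto_zero_of_le_rpow (K := 12 * |p| * |p - 1| + 8 * |p| * |p - 1| * |p - 2|) hp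
      fun t ↦ ?_
    calc |12 * p * (p - 1) * t * (1 + t ^ 2) ^ (p - 2) +
          8 * p * (p - 1) * (p - 2) * t ^ 3 * (1 + t ^ 2) ^ (p - 3)|
        ≤ |12 * p * (p - 1) * t * (1 + t ^ 2) ^ (p - 2)| +
            |8 * p * (p - 1) * (p - 2) * t ^ 3 * (1 + t ^ 2) ^ (p - 3)| := abs_add_le _ _
      _ = 12 * |p| * |p - 1| * (|t| * (1 + t ^ 2) ^ (p - 2)) +
            8 * |p| * |p - 1| * |p - 2| * (|t| ^ 3 * (1 + t ^ 2) ^ (p - 3)) := by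
          simp only [abs_mul, abs_of_nonneg (hfq t _), abs_pow]
          norm_num
          ring
      _ ≤ 12 * |p| * |p - 1| * (1 + t ^ 2) ^ p +
            8 * |p| * |p - 1| * |p - 2| * (1 + t ^ 2) ^ p :=
          add_le_add (mul_le_mul_of_nonneg_left (b1' t) (by positivity))
            (mul_le_mul_of_nonneg_left (b3 t) (by positivity))
      _ = (12 * |p| * |p - 1| + 8 * |p| * |p - 1| * |p - 2|) * (1 + t ^ 2) ^ p := by ring

end Summit.FinalStateConjecture.FinalStateConjecture.Theorems.WeightedQuasiStationarity.Negative

end
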